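import Literature.NumberTheory.Weil1964.LocalWeilIndex
import HarnessLib

/-!
# Weil's Gauss integrals of a binary diagonal form over arbitrary lattices of `F × F`

Topic `NumberTheory/Weil1964`; namespace `Literature.NumberTheory.Weil1964`. KERNEL mathematics only
(plumbing definitions with bodies + theorems; no named fact, no `axiom`, no `sorry`). Sequel of
`LocalQuadraticGaussIntegral.lean` / `LocalWeilIndex.lean` (one variable), first step of the two-variable theory
needed for the Hilbert-symbol law `γ(a)γ(b) = γ(1)γ(ab)(a,b)` ([Weil1964] n° 28), whose proof runs through the
binary norm forms `b(x² - a y²)` integrated over lattices that are NOT coordinate boxes.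

For a non-archimedean local field `F` (Haar measure `μ`, character `ψ` of conductor exponent `d`, `‖2‖ = q^{-v₂}`)
and the binary diagonal form `f(x, y) = b₁ x² + b₂ y²` (`‖bᵢ‖ = q^{-vᵢ}`) we define Weil's

  `g(f, D) = ∫_D ψ(f(z)) dz`   (`gaussBox ψ μ b₁ b₂ D`, `D ⊆ F × F`, measure `μ × μ`)

([Weil1964], Chap. II n° 27 p. 175, now for an arbitrary lattice `D`, "réseau" = compact open `𝒪`-submodule) and prove:

* §1 boxes: `g(f, 𝔭^m × 𝔭^m) = g(b₁, 𝔭^m) · g(b₂, 𝔭^m)` (Fubini) — the diagonal case of n° 25 Prop. 3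
  (`γ(f₁ ⊕ f₂) = γ(f₁) γ(f₂)`);
* §2 the COSET FORMULA `∫_{z₀ + 𝔭^ℓ × 𝔭^ℓ} ψ(f) = ψ(f(z₀)) μ(𝔭^ℓ)² [2b₁x₀ ∈ 𝔭^{d-ℓ}] [2b₂y₀ ∈ 𝔭^{d-ℓ}]` (Weil's (27));
* §3 a compact subset of `F × F` saturated by the open subgroup `𝔭^ℓ × 𝔭^ℓ` is a finite disjoint union of its
  cosets, and the corresponding decomposition of set integrals;
* §4 **INDEPENDENCE OF THE LATTICE** (n° 27: "`g(f, M)` est indépendant de `M` pourvu que `M ⊃ L′`"): for every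
  compact `D ⊆ F × F` stable under translation by `𝔭^ℓ × 𝔭^ℓ` and containing the box `𝔭^{m₀} × 𝔭^{m₀}`, with
  `(ℓ, m₀)` in the explicit admissible range, `g(f, D) = g(f, 𝔭^{m₀} × 𝔭^{m₀})`; in particular
  `g(f, D) = weilGauss(b₁) · weilGauss(b₂)` and the index of `f` is `γ(b₁) γ(b₂)`.

NOT here: the change of variables under `GL₂(F)` (module `‖det‖`) and the norm-form computation of n° 28.

## References

* [Weil1964] A. Weil, *Sur certains groupes d'opérateurs unitaires*, Acta Math. 111 (1964) 143–211, Chap. II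
  n° 25 Prop. 3 (p. 173), n° 27 (pp. 174–175).
-/

set_option autoImplicit false

noncomputable section

open MeasureTheory ValuativeRel Filter Topology Set
open scoped NNReal ENNReal Pointwise
open Literature.NumberTheory.GaloisRepresentations.IsNonarchimedeanLocalField
open Literature.NumberTheory.Automorphic

namespace Literature.NumberTheory.Weil1964

variable {F : Type*} [Field F] [ValuativeRel F] [TopologicalSpace F] [IsNonarchimedeanLocalField F]

/-! ## §0 Boxes `𝔭^m × 𝔭^m` and the binary second-degree character -/

section Box

variable (F) in
/-- the box lattice `𝔭^m × 𝔭^m ⊆ F × F` (a "réseau" of `F²`). [cite: Weil1964, Chap. II n° 27, p. 174] -/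
def primePowBox (m : ℤ) : Set (F × F) := primePowBall F m ×ˢ primePowBall F m

/-- membership in the box lattice. [cite: Weil1964, Chap. II n° 27, p. 174] -/
theorem mem_primePowBox_iff {m : ℤ} {z : F × F} :
    z ∈ primePowBox F m ↔ z.1 ∈ primePowBall F m ∧ z.2 ∈ primePowBall F m := Set.mem_prod

/-- `0 ∈ 𝔭^m × 𝔭^m` (a lattice is a subgroup). [cite: Weil1964, Chap. II n° 27, p. 174] -/
theorem zero_mem_primePowBox (m : ℤ) : (0 : F × F) ∈ primePowBox F m :=
  mem_primePowBox_iff.2 ⟨zero_mem_primePowBall m, zero_mem_primePowBall m⟩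

/-- `𝔭^m × 𝔭^m` is closed under addition (a lattice is a subgroup). [cite: Weil1964, Chap. II n° 27, p. 174] -/
theorem add_mem_primePowBox {m : ℤ} {z w : F × F} (hz : z ∈ primePowBox F m) (hw : w ∈ primePowBox F m) :
    z + w ∈ primePowBox F m :=
  mem_primePowBox_iff.2 ⟨add_mem_primePowBall (mem_primePowBox_iff.1 hz).1 (mem_primePowBox_iff.1 hw).1,
    add_mem_primePowBall (mem_primePowBox_iff.1 hz).2 (mem_primePowBox_iff.1 hw).2⟩

/-- `𝔭^m × 𝔭^m` is closed under negation (a lattice is a subgroup). [cite: Weil1964, Chap. II n° 27, p. 174] -/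
theorem neg_mem_primePowBox {m : ℤ} {z : F × F} (hz : z ∈ primePowBox F m) : -z ∈ primePowBox F m :=
  mem_primePowBox_iff.2 ⟨neg_mem_primePowBall (mem_primePowBox_iff.1 hz).1,
    neg_mem_primePowBall (mem_primePowBox_iff.1 hz).2⟩

/-- the box lattices decrease. [cite: Weil1964, Chap. II n° 27, p. 174] -/
theorem primePowBox_antitone {m m' : ℤ} (h : m ≤ m') : primePowBox F m' ⊆ primePowBox F m :=
  Set.prod_mono (primePowBall_antitone h) (primePowBall_antitone h)

/-- the box lattice is open ("réseau" = compact open `𝒪`-module). [cite: Weil1964, Chap. II n° 27, p. 174] -/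
theorem isOpen_primePowBox (m : ℤ) : IsOpen (primePowBox F m) :=
  (isOpen_primePowBall m).prod (isOpen_primePowBall m)

/-- the box lattice is compact ("réseau" = compact open `𝒪`-module). [cite: Weil1964, Chap. II n° 27, p. 174] -/
theorem isCompact_primePowBox (m : ℤ) : IsCompact (primePowBox F m) :=
  (isCompact_primePowBall m).prod (isCompact_primePowBall m)

/-- a class modulo the box lattice is the product of the coordinate classes. [cite: Weil1964, Chap. II n° 27, p. 174] -/
theorem vadd_primePowBox (a : F × F) (m : ℤ) :
    a +ᵥ primePowBox F m = (a.1 +ᵥ primePowBall F m) ×ˢ (a.2 +ᵥ primePowBall F m) := by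
  ext z
  rw [Set.mem_vadd_set_iff_neg_vadd_mem, Set.mem_prod, Set.mem_vadd_set_iff_neg_vadd_mem,
    Set.mem_vadd_set_iff_neg_vadd_mem]
  exact mem_primePowBox_iff

/-- two classes modulo the box lattice that meet are equal. [cite: Weil1964, Chap. II n° 27, p. 174] -/
theorem vadd_primePowBox_eq_of_mem {m : ℤ} {a u : F × F} (hu : u ∈ a +ᵥ primePowBox F m) :
    u +ᵥ primePowBox F m = a +ᵥ primePowBox F m := by
  rw [Set.mem_vadd_set_iff_neg_vadd_mem, vadd_eq_add] at hu
  ext z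
  rw [Set.mem_vadd_set_iff_neg_vadd_mem, Set.mem_vadd_set_iff_neg_vadd_mem, vadd_eq_add, vadd_eq_add]
  constructor
  · intro hz
    have e : -a + z = (-a + u) + (-u + z) := by abel
    rw [e]; exact add_mem_primePowBox hu hz
  · intro hz
    have e : -u + z = -(-a + u) + (-a + z) := by abel
    rw [e]; exact add_mem_primePowBox (neg_mem_primePowBox hu) hz

variable (ψ : AddChar F Circle)

/-- the second-degree character `(x, y) ↦ ψ(b₁ x² + b₂ y²) = ψ(b₁ x²) ψ(b₂ y²)` of the binary diagonal form
`f = b₁ x² ⊕ b₂ y²`. [cite: Weil1964, Chap. II n° 25, p. 173] -/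
def psiSq₂ (b₁ b₂ : F) (z : F × F) : ℂ := psiSq ψ b₁ z.1 * psiSq ψ b₂ z.2

omit [ValuativeRel F] [TopologicalSpace F] [IsNonarchimedeanLocalField F] in
/-- `ψ(b₁ x²) ψ(b₂ y²) = ψ(b₁ x² + b₂ y²)`. [cite: Weil1964, Chap. II n° 25, p. 173] -/
theorem psiSq₂_apply (b₁ b₂ : F) (z : F × F) : psiSq₂ ψ b₁ b₂ z = ψ (b₁ * z.1 ^ 2 + b₂ * z.2 ^ 2) := by
  rw [psiSq₂, psiSq, psiSq, ← Circle.coe_mul, ← AddChar.map_add_eq_mul]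

/-- **Weil's Gauss integral of the binary form over a subset `D ⊆ F × F`**: `g(f, D) = ∫_D ψ(f(z)) dz`
(product Haar measure). [cite: Weil1964, Chap. II n° 27, p. 175] -/
def gaussBox [MeasurableSpace F] (μ : Measure F) (b₁ b₂ : F) (D : Set (F × F)) : ℂ :=
  ∫ z in D, psiSq₂ ψ b₁ b₂ z ∂(μ.prod μ)

end Box

/-- `F` is second countable (instance helper). [folklore] -/
private theorem secondCountable : SecondCountableTopology F := secondCountableTopology_localField F

variable [MeasurableSpace F] [BorelSpace F] (μ : Measure F) [μ.IsAddHaarMeasure] {ψ : AddChar F Circle}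

omit [BorelSpace F] in
/-- a Haar measure on `F` is `σ`-finite (instance helper: `F` is `σ`-compact). [folklore] -/
private theorem sigmaFinite_haar : SigmaFinite μ := by
  haveI : T2Space F :=
    (Literature.NumberTheory.GaloisRepresentations.IsNonarchimedeanLocalField.isLocalField F).toT2Space
  haveI : LocallyCompactSpace F :=
    (Literature.NumberTheory.GaloisRepresentations.IsNonarchimedeanLocalField.isLocalField F).toLocallyCompactSpace
  haveI : SecondCountableTopology F := secondCountable
  infer_instance

/-! ## §1 Boxes: `g(f, 𝔭^m × 𝔭^m) = g(b₁, 𝔭^m) g(b₂, 𝔭^m)` -/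

section Boxes

omit [ValuativeRel F] [TopologicalSpace F] [IsNonarchimedeanLocalField F] [BorelSpace F]
  [μ.IsAddHaarMeasure] in
/-- unfolding. [cite: Weil1964, Chap. II n° 27, p. 175] -/
theorem gaussBox_def (b₁ b₂ : F) (D : Set (F × F)) :
    gaussBox ψ μ b₁ b₂ D = ∫ z in D, psiSq₂ ψ b₁ b₂ z ∂(μ.prod μ) := rfl

omit [BorelSpace F] in
/-- **`g(b₁ x² ⊕ b₂ y², 𝔭^m × 𝔭^m) = g(b₁, 𝔭^m) · g(b₂, 𝔭^m)`** (Fubini) — the integral form of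
`γ(f₁ ⊕ f₂) = γ(f₁)γ(f₂)` for the box lattices. [cite: Weil1964, Chap. II n° 25 Prop. 3, p. 173] -/
theorem gaussBox_primePowBox (b₁ b₂ : F) (m : ℤ) :
    gaussBox ψ μ b₁ b₂ (primePowBox F m) = gaussBall ψ μ b₁ m * gaussBall ψ μ b₂ m := by
  haveI := sigmaFinite_haar μ
  rw [gaussBox_def, primePowBox, gaussBall_def, gaussBall_def, ← setIntegral_prod_mul]
  rfl

/-- hence on the common stable range `g(f, 𝔭^m × 𝔭^m) = g(b₁) g(b₂)` (the stable values).
[cite: Weil1964, Chap. II n° 27, p. 175] -/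
theorem gaussBox_primePowBox_eq_weilGauss_mul {d : ℤ} (hd : ψ.HasConductorExp d) {b₁ b₂ : F} {v₁ v₂' v₂ : ℤ}
    (hb₁ : normAbs F b₁ = (residueFieldCard F : ℝ≥0)⁻¹ ^ v₁) (hb₂ : normAbs F b₂ = (residueFieldCard F : ℝ≥0)⁻¹ ^ v₂')
    (h2 : normAbs F (2 : F) = (residueFieldCard F : ℝ≥0)⁻¹ ^ v₂) {m : ℤ} (hm₁ : 2 * m ≤ d - v₁ - 2 * v₂)
    (hm₂ : 2 * m ≤ d - v₂' - 2 * v₂) :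
    gaussBox ψ μ b₁ b₂ (primePowBox F m) = weilGauss ψ μ b₁ * weilGauss ψ μ b₂ := by
  rw [gaussBox_primePowBox, weilGauss_eq_gaussBall μ hd hb₁ h2 hm₁, weilGauss_eq_gaussBall μ hd hb₂ h2 hm₂]

end Boxes

/-! ## §2 The coset formula in `F × F` -/

section Coset

open scoped Classical in
/-- **coset formula for the binary form**: if `b₁ 𝔭^{2ℓ}, b₂ 𝔭^{2ℓ} ⊆ 𝔭^d` then
`∫_{z₀ + 𝔭^ℓ×𝔭^ℓ} ψ(f) = ψ(f(z₀)) · (μ(𝔭^ℓ)[2b₁x₀ ∈ 𝔭^{d-ℓ}]) · (μ(𝔭^ℓ)[2b₂y₀ ∈ 𝔭^{d-ℓ}])` (the product of the two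
one-variable coset formulas, Weil's (27) for `L = 𝔭^ℓ × 𝔭^ℓ`). [cite: Weil1964, Chap. II n° 27, (27) p. 174] -/
theorem setIntegral_vadd_primePowBox_psiSq₂ {d : ℤ} (hd : ψ.HasConductorExp d) (b₁ b₂ : F) (z₀ : F × F)
    {ℓ : ℤ} (h₁ : ∀ y ∈ primePowBall F ℓ, b₁ * y ^ 2 ∈ primePowBall F d)
    (h₂ : ∀ y ∈ primePowBall F ℓ, b₂ * y ^ 2 ∈ primePowBall F d) :
    ∫ z in z₀ +ᵥ primePowBox F ℓ, psiSq₂ ψ b₁ b₂ z ∂(μ.prod μ) =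
      psiSq₂ ψ b₁ b₂ z₀ *
        ((if 2 * b₁ * z₀.1 ∈ primePowBall F (d - ℓ) then (μ.real (primePowBall F ℓ) : ℂ) else 0) *
         (if 2 * b₂ * z₀.2 ∈ primePowBall F (d - ℓ) then (μ.real (primePowBall F ℓ) : ℂ) else 0)) := by
  haveI := sigmaFinite_haar μ
  rw [vadd_primePowBox, show (fun z : F × F => psiSq₂ ψ b₁ b₂ z) = fun z => psiSq ψ b₁ z.1 * psiSq ψ b₂ z.2
      from rfl, setIntegral_prod_mul, setIntegral_vadd_primePowBall_psiSq μ hd b₁ z₀.1 h₁,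
    setIntegral_vadd_primePowBall_psiSq μ hd b₂ z₀.2 h₂, psiSq₂]
  ring

end Coset

/-! ## §3 Finite coset decompositions -/

section Decomposition

omit [MeasurableSpace F] [BorelSpace F] in
/-- **a compact set saturated by the open subgroup `𝔭^ℓ × 𝔭^ℓ` is a finite disjoint union of its cosets**
(finite subcover by open cosets; cosets that meet coincide). [folklore] -/
private theorem exists_finset_cosets {ℓ : ℤ} {K : Set (F × F)} (hK : IsCompact K)
    (hsat : ∀ x ∈ K, ∀ h ∈ primePowBox F ℓ, x + h ∈ K) :
    ∃ C : Finset (Set (F × F)), (∀ B ∈ C, ∃ a ∈ K, B = a +ᵥ primePowBox F ℓ) ∧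
      (↑C : Set (Set (F × F))).PairwiseDisjoint (fun B => B) ∧ K = ⋃ B ∈ C, B := by
  classical
  obtain ⟨A, hAK, hAfin, hA⟩ := hK.elim_finite_subcover_image (b := K)
    (c := fun a : F × F => a +ᵥ primePowBox F ℓ) (fun a _ => (isOpen_primePowBox ℓ).vadd a)
    (fun a ha => Set.mem_iUnion₂.2 ⟨a, ha, by
      rw [Set.mem_vadd_set_iff_neg_vadd_mem, vadd_eq_add, neg_add_cancel]; exact zero_mem_primePowBox ℓ⟩)
  obtain ⟨A', hA'⟩ := hAfin.exists_finset_coe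
  subst hA'
  refine ⟨A'.image fun a => a +ᵥ primePowBox F ℓ, ?_, ?_, ?_⟩
  · intro B hB
    obtain ⟨a, ha, rfl⟩ := Finset.mem_image.1 hB
    exact ⟨a, hAK (Finset.mem_coe.2 ha), rfl⟩
  · intro B hB B' hB' hne
    obtain ⟨a, -, rfl⟩ := Finset.mem_image.1 (Finset.mem_coe.1 hB)
    obtain ⟨a', -, rfl⟩ := Finset.mem_image.1 (Finset.mem_coe.1 hB')
    rw [Function.onFun, Set.disjoint_left]
    intro u hu hu'
    exact hne ((vadd_primePowBox_eq_of_mem hu).symm.trans (vadd_primePowBox_eq_of_mem hu'))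
  · apply Set.Subset.antisymm
    · intro x hx
      obtain ⟨a, ha, hxa⟩ := Set.mem_iUnion₂.1 (hA hx)
      exact Set.mem_iUnion₂.2 ⟨a +ᵥ primePowBox F ℓ, Finset.mem_image.2 ⟨a, Finset.mem_coe.1 ha, rfl⟩, hxa⟩
    · intro x hx
      obtain ⟨B, hB, hxB⟩ := Set.mem_iUnion₂.1 hx
      obtain ⟨a, ha, rfl⟩ := Finset.mem_image.1 hB
      obtain ⟨h, hh, rfl⟩ := Set.mem_vadd_set.1 hxB
      exact hsat a (hAK (Finset.mem_coe.2 ha)) h hh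

/-- cosets of boxes are measurable. [folklore] -/
private theorem measurableSet_vadd_primePowBox (ℓ : ℤ) (a : F × F) : MeasurableSet (a +ᵥ primePowBox F ℓ) := by
  rw [vadd_primePowBox]
  exact (measurableSet_vadd_primePowBall ℓ a.1).prod (measurableSet_vadd_primePowBall ℓ a.2)

omit [μ.IsAddHaarMeasure] in
/-- `ψ(f)` is integrable on every set of finite product measure. [folklore] -/
private theorem integrableOn_psiSq₂ (hψ : Continuous ψ) (b₁ b₂ : F) {D : Set (F × F)} (hD : (μ.prod μ) D ≠ ∞) :
    IntegrableOn (psiSq₂ ψ b₁ b₂) D (μ.prod μ) := by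
  haveI : SecondCountableTopology F := secondCountable
  exact Measure.integrableOn_of_bounded (M := 1) hD
    (((continuous_psiSq hψ b₁).comp continuous_fst).mul
      ((continuous_psiSq hψ b₂).comp continuous_snd)).aestronglyMeasurable
    (Eventually.of_forall fun z => by rw [psiSq₂, norm_mul, norm_psiSq, norm_psiSq, one_mul])

end Decomposition

/-! ## §4 Independence of the lattice -/

section Independence

open scoped Classical in
/-- **INDEPENDENCE OF THE LATTICE** (Weil: `g(f, M)` does not depend on the lattice `M ⊇ L'`): let `ψ` have
conductor exponent `d`, `‖b₁‖ = q^{-v₁}`, `‖b₂‖ = q^{-v₂'}`, `‖2‖ = q^{-v₂}`, and let `ℓ, m₀` satisfy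
`d ≤ v₁ + 2ℓ`, `d ≤ v₂' + 2ℓ` (so `ψ ∘ f = 1` on `L = 𝔭^ℓ × 𝔭^ℓ`), `ℓ + m₀ ≤ d - v₂ - v₁`, `ℓ + m₀ ≤ d - v₂ - v₂'`
(so the dual lattice `L'` lies in the box `𝔭^{m₀} × 𝔭^{m₀}`) and `m₀ ≤ ℓ`. Then for every compact `D ⊆ F × F` stable
under translations by `L` and containing `𝔭^{m₀} × 𝔭^{m₀}`: `g(f, D) = g(f, 𝔭^{m₀} × 𝔭^{m₀})`.
[cite: Weil1964, Chap. II n° 27, p. 175] -/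
theorem gaussBox_eq_gaussBox_primePowBox {d : ℤ} (hd : ψ.HasConductorExp d) {b₁ b₂ : F} {v₁ v₂' v₂ : ℤ}
    (hb₁ : normAbs F b₁ = (residueFieldCard F : ℝ≥0)⁻¹ ^ v₁) (hb₂ : normAbs F b₂ = (residueFieldCard F : ℝ≥0)⁻¹ ^ v₂')
    (h2 : normAbs F (2 : F) = (residueFieldCard F : ℝ≥0)⁻¹ ^ v₂) {ℓ m₀ : ℤ} (hℓ₁ : d ≤ v₁ + 2 * ℓ)
    (hℓ₂ : d ≤ v₂' + 2 * ℓ) (hm₁ : ℓ + m₀ ≤ d - v₂ - v₁) (hm₂ : ℓ + m₀ ≤ d - v₂ - v₂') (hmℓ : m₀ ≤ ℓ)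
    {D : Set (F × F)} (hDc : IsCompact D) (hDsat : ∀ x ∈ D, ∀ h ∈ primePowBox F ℓ, x + h ∈ D)
    (hDm : primePowBox F m₀ ⊆ D) :
    gaussBox ψ μ b₁ b₂ D = gaussBox ψ μ b₁ b₂ (primePowBox F m₀) := by
  haveI : SecondCountableTopology F := secondCountable
  haveI : T2Space F :=
    (Literature.NumberTheory.GaloisRepresentations.IsNonarchimedeanLocalField.isLocalField F).toT2Space
  haveI := sigmaFinite_haar μ
  have hψ : Continuous ψ := continuous_of_hasConductorExp hd
  -- triviality of `ψ ∘ f` on `L`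
  have hL₁ : ∀ y ∈ primePowBall F ℓ, b₁ * y ^ 2 ∈ primePowBall F d := by
    intro y hy
    have hb : b₁ ∈ primePowBall F v₁ := by rw [mem_primePowBall_iff, hb₁]
    have h3 := mul_mem_primePowBall (mul_mem_primePowBall hb hy) hy
    rw [show b₁ * y * y = b₁ * y ^ 2 by ring] at h3
    exact primePowBall_antitone (by omega) h3
  have hL₂ : ∀ y ∈ primePowBall F ℓ, b₂ * y ^ 2 ∈ primePowBall F d := by
    intro y hy
    have hb : b₂ ∈ primePowBall F v₂' := by rw [mem_primePowBall_iff, hb₂]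
    have h3 := mul_mem_primePowBall (mul_mem_primePowBall hb hy) hy
    rw [show b₂ * y * y = b₂ * y ^ 2 by ring] at h3
    exact primePowBall_antitone (by omega) h3
  -- the complement `K = D ∖ box m₀`
  set K : Set (F × F) := D \ primePowBox F m₀ with hKdef
  have hKc : IsCompact K := hDc.diff (isOpen_primePowBox m₀)
  have hKsat : ∀ x ∈ K, ∀ h ∈ primePowBox F ℓ, x + h ∈ K := by
    intro x hx h hh
    refine ⟨hDsat x hx.1 h hh, fun hxh => hx.2 ?_⟩
    have := add_mem_primePowBox hxh (neg_mem_primePowBox (primePowBox_antitone hmℓ hh))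
    rwa [add_neg_cancel_right] at this
  obtain ⟨C, hC, hCdisj, hKC⟩ := exists_finset_cosets hKc hKsat
  -- each coset integral vanishes
  have hterm : ∀ B ∈ C, ∫ z in B, psiSq₂ ψ b₁ b₂ z ∂(μ.prod μ) = 0 := by
    intro B hB
    obtain ⟨a, haK, rfl⟩ := hC B hB
    rw [setIntegral_vadd_primePowBox_psiSq₂ μ hd b₁ b₂ a hL₁ hL₂]
    have haD : a ∉ primePowBox F m₀ := haK.2
    rw [mem_primePowBox_iff, not_and_or] at haD
    rcases haD with ha1 | ha2
    · have : 2 * b₁ * a.1 ∉ primePowBall F (d - ℓ) := by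
        intro hmem
        apply ha1
        have ha0 : a.1 ≠ 0 := by rintro h; exact ha1 (h ▸ zero_mem_primePowBall m₀)
        obtain ⟨k, hk⟩ := exists_normAbs_eq_inv_zpow ha0
        rw [mem_primePowBall_iff, map_mul, map_mul, h2, hb₁, hk, ← zpow_add₀ inv_residueFieldCard_pos.ne',
          ← zpow_add₀ inv_residueFieldCard_pos.ne', inv_residueFieldCard_zpow_le_iff] at hmem
        rw [mem_primePowBall_iff, hk, inv_residueFieldCard_zpow_le_iff]
        omega
      rw [if_neg this, zero_mul, mul_zero]
    · have : 2 * b₂ * a.2 ∉ primePowBall F (d - ℓ) := by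
        intro hmem
        apply ha2
        have ha0 : a.2 ≠ 0 := by rintro h; exact ha2 (h ▸ zero_mem_primePowBall m₀)
        obtain ⟨k, hk⟩ := exists_normAbs_eq_inv_zpow ha0
        rw [mem_primePowBall_iff, map_mul, map_mul, h2, hb₂, hk, ← zpow_add₀ inv_residueFieldCard_pos.ne',
          ← zpow_add₀ inv_residueFieldCard_pos.ne', inv_residueFieldCard_zpow_le_iff] at hmem
        rw [mem_primePowBall_iff, hk, inv_residueFieldCard_zpow_le_iff]
        omega
      rw [if_neg this, mul_zero, mul_zero]
  -- finiteness of measures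
  have hDfin : (μ.prod μ) D ≠ ∞ := (hDc.measure_lt_top (μ := μ.prod μ)).ne
  -- assemble
  have hsplit : D = primePowBox F m₀ ∪ K := by rw [hKdef, Set.union_sdiff_cancel hDm]
  calc gaussBox ψ μ b₁ b₂ D
      = ∫ z in primePowBox F m₀ ∪ K, psiSq₂ ψ b₁ b₂ z ∂(μ.prod μ) := by rw [gaussBox_def, ← hsplit]
    _ = gaussBox ψ μ b₁ b₂ (primePowBox F m₀) + ∫ z in K, psiSq₂ ψ b₁ b₂ z ∂(μ.prod μ) := by
        rw [gaussBox_def, setIntegral_union Set.disjoint_sdiff_right (hDc.measurableSet.diff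
            (isOpen_primePowBox m₀).measurableSet)
          (integrableOn_psiSq₂ μ hψ b₁ b₂ ((measure_mono hDm).trans_lt hDfin.lt_top).ne)
          (integrableOn_psiSq₂ μ hψ b₁ b₂ ((measure_mono Set.sdiff_subset).trans_lt hDfin.lt_top).ne)]
    _ = gaussBox ψ μ b₁ b₂ (primePowBox F m₀) + ∑ B ∈ C, ∫ z in B, psiSq₂ ψ b₁ b₂ z ∂(μ.prod μ) := by
        congr 1
        rw [hKC]
        refine integral_biUnion_finset C (fun B hB => ?_) hCdisj (fun B hB => ?_)
        · obtain ⟨a, -, rfl⟩ := hC B hB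
          exact measurableSet_vadd_primePowBox ℓ a
        · refine integrableOn_psiSq₂ μ hψ b₁ b₂ ((measure_mono ?_).trans_lt hDfin.lt_top).ne
          intro z hz
          exact (hKC.symm ▸ Set.mem_biUnion hB hz : z ∈ K).1
    _ = gaussBox ψ μ b₁ b₂ (primePowBox F m₀) := by rw [Finset.sum_eq_zero hterm, add_zero]

/-- admissible `(ℓ, m₀)` exist. [folklore] -/
private theorem exists_admissible (d v₁ v₂' v₂ : ℤ) :
    ∃ ℓ m₀ : ℤ, d ≤ v₁ + 2 * ℓ ∧ d ≤ v₂' + 2 * ℓ ∧ ℓ + m₀ ≤ d - v₂ - v₁ ∧ ℓ + m₀ ≤ d - v₂ - v₂' ∧ m₀ ≤ ℓ ∧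
      2 * m₀ ≤ d - v₁ - 2 * v₂ ∧ 2 * m₀ ≤ d - v₂' - 2 * v₂ := by
  refine ⟨|d| + |v₁| + |v₂'|, -(2 * (|d| + |v₁| + |v₂'| + |v₂|)), ?_, ?_, ?_, ?_, ?_, ?_, ?_⟩ <;>
    cases abs_cases d <;> cases abs_cases v₁ <;> cases abs_cases v₂' <;> cases abs_cases v₂ <;> omega

/-- **`g(f, D) = g(b₁) g(b₂)` for every lattice `D` large enough**: for `ψ` continuous non-trivial, `b₁ b₂ ≠ 0`,
`2 ≠ 0`, there are `ℓ` and `m₀ ≤ ℓ` such that every compact `D ⊇ 𝔭^{m₀} × 𝔭^{m₀}` stable under `𝔭^ℓ × 𝔭^ℓ` has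
`g(f, D) = weilGauss(b₁) · weilGauss(b₂)`; so the Weil index of the binary diagonal form is `γ(b₁) γ(b₂)` whatever
lattices are used. [cite: Weil1964, Chap. II n° 25 Prop. 3 and n° 27, pp. 173–175] -/
theorem exists_forall_gaussBox_eq_weilGauss_mul (hψ : ψ.IsContinuousNontrivial) {b₁ b₂ : F} (hb₁ : b₁ ≠ 0)
    (hb₂ : b₂ ≠ 0) (htwo : (2 : F) ≠ 0) :
    ∃ ℓ m₀ : ℤ, m₀ ≤ ℓ ∧ ∀ D : Set (F × F), IsCompact D → (∀ x ∈ D, ∀ h ∈ primePowBox F ℓ, x + h ∈ D) →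
      primePowBox F m₀ ⊆ D → gaussBox ψ μ b₁ b₂ D = weilGauss ψ μ b₁ * weilGauss ψ μ b₂ := by
  obtain ⟨d, v₁, v₂, hd, hv₁, hv₂⟩ := exists_exponents hψ hb₁ htwo
  obtain ⟨v₂', hv₂'⟩ := exists_normAbs_eq_inv_zpow hb₂
  obtain ⟨ℓ, m₀, h1, h2', h3, h4, h5, h6, h7⟩ := exists_admissible d v₁ v₂' v₂
  refine ⟨ℓ, m₀, h5, fun D hDc hDsat hDm => ?_⟩
  rw [gaussBox_eq_gaussBox_primePowBox μ hd hv₁ hv₂' hv₂ h1 h2' h3 h4 h5 hDc hDsat hDm,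
    gaussBox_primePowBox_eq_weilGauss_mul μ hd hv₁ hv₂' hv₂ h6 h7]

end Independence

end Literature.NumberTheory.Weil1964
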